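import Mathlib
import Literature.AlgebraicGeometry.Resolution.PlaneGermNonNCCountRadical
import Literature.AlgebraicGeometry.Resolution.PlaneGermBlowup
import Literature.AlgebraicGeometry.Resolution.PlaneGermBlowupCalculus
import Summits.ResolutionOfSingularities.ResolutionOfSingularities.Theorems.WeightedInvariantLocalWeightedDropNonNCCountAssembly
import Summits.ResolutionOfSingularities.ResolutionOfSingularities.Theorems.WeightedInvariantLocalWeightedDropBlowupSuccessorToolkit
import Summits.ResolutionOfSingularities.ResolutionOfSingularities.Theorems.WeightedInvariantLocalWeightedDropBlowupScaling
import Summits.ResolutionOfSingularities.ResolutionOfSingularities.Theorems.WeightedInvariantLocalWeightedDropPlaneNonNCCount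

/-!
# `WeightedInvariant.LocalWeightedDrop`, line `hasse-ridge-face-selection`: the non-NC count is radical-monotone

Crux item stmt-ResolutionOfSingularities-8899 (route `ResolutionOfSingularities/WeightedInvariant`),
skeleton v16 of the line `hasse-ridge-face-selection`, stub `stub_planeCountRadical` (S3a), PROVED here
(statement verbatim from the ledger registration).

**Statement.**  For every field `k` the Literature named fact `PlaneGermNonNCCountRad k` holds: there is
`ν : k[[x, y]] → ℕ` with, for non-zero germs, (i) `ν b = 0 ↔ PlaneGerm.IsNC b`; (ii) RADICAL MONOTONICITY
`d ≠ 0 → b ∣ d ^ (N + 1) → ν b ≤ ν d`; (iii) strict drop of `ν` at every exceptional point of the first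
blow-up of a germ whose support is not a normal crossing (measured on `x · slice`).

**Proof.**  Re-run the assembly of `stub_nonNCCountAssembly`
(`…Theorems/WeightedInvariantLocalWeightedDropNonNCCountAssembly.lean`): `ν b :=` the length of the longest
chain of bad steps (`PlaneGerm.IsBadStep`) from `b` (`NonNCCountAssembly.exists_chainPred`, `chain_bounded`,
`exists_count`, fed with `stub_blowupSuccessorToolkit`, `stub_blowupScaling`, `noInfiniteBadChain`); clauses
(i) and (iii) are copied.  The new input is CHAIN LIFTING ALONG RADICAL DIVISIBILITY
(`PlaneCountRadical.chain_of_dvd_pow`): if `d ≠ 0`, `b ∣ d ^ (N + 1)` and a chain of `n` bad steps starts at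
`b`, then one starts at `d`.  Indeed (a) normal-crossing support passes to powers (same coordinates, `u ↦ u^{N+1}`)
and to divisors (`PlaneGerm.isNC_of_dvd`), so `¬ IsNC b → ¬ IsNC d`; (b) in a fixed chart `Φ` (slope `t` or
vertical) write `d ^ (N + 1) = b · q`; transforms are multiplicative (`PlaneGerm.exists_isTransform_mul`), so the
first-neighbourhood germ `D_b` of `b` divides the one of `d ^ (N + 1)`, which is `x · st_d ^ (N + 1)` (orders of
powers multiply in the domain `k[[x, y]]`, `subst` is a ring map, cancel the power of `x`) and hence divides
`D_d ^ (N + 1) = (x · st_d)^{N+1}`.  So the relation `(b ∣ d^{N+1}, d ≠ 0)` propagates from `(b, d)` to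
`(D_b, D_d)` chart by chart, and the induction on `n` of `NonNCCountAssembly.chain_of_dvd` goes through verbatim.
-/

set_option linter.dupNamespace false -- mandated namespace of this single-conjunct summit

namespace Summit.ResolutionOfSingularities.ResolutionOfSingularities.Theorems

open Literature.AlgebraicGeometry.Resolution

namespace PlaneCountRadical

open MvPowerSeries

variable {k : Type} [Field k]

/-! ### Powers: orders multiply, normal crossings persist, transforms of powers -/

/-- Orders of powers in the domain `k[[x, y]]`: `ord (d ^ (n + 1)) = ord d · (n + 1)`. -/
theorem order_pow_succ {d : MvPowerSeries (Fin 2) k} {m : ℕ} (hm : d.order = m) :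
    ∀ n : ℕ, (d ^ (n + 1)).order = ((m * (n + 1) : ℕ) : ℕ∞)
  | 0 => by rw [zero_add, pow_one, mul_one, hm]
  | n + 1 => by
    rw [pow_succ, order_mul, order_pow_succ hm n, hm, ← Nat.cast_add]
    rfl

/-- Normal-crossing support passes to powers (same coordinates, the unit raised to the power). -/
theorem isNC_pow {d : MvPowerSeries (Fin 2) k} (hd : PlaneGerm.IsNC d) (n : ℕ) :
    PlaneGerm.IsNC (d ^ n) := by
  obtain ⟨Φ, u, a, c, hΦ0, hdet, hu, hsub⟩ := hd
  refine ⟨Φ, u ^ n, a * n, c * n, hΦ0, hdet, ?_, ?_⟩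
  · rw [map_pow]
    exact pow_ne_zero _ hu
  · rw [subst_pow (hasSubst_of_constantCoeff_zero hΦ0), hsub, mul_pow, mul_pow, ← pow_mul, ← pow_mul]

/-- Normal-crossing support descends along radical divisibility `b ∣ d ^ (N + 1)`. -/
theorem isNC_of_dvd_pow {b d : MvPowerSeries (Fin 2) k} {N : ℕ} (hbd : b ∣ d ^ (N + 1))
    (hd : PlaneGerm.IsNC d) : PlaneGerm.IsNC b :=
  PlaneGerm.isNC_of_dvd hbd (isNC_pow hd _)

/-- In a fixed chart, the transform germ of `d ^ (N + 1)` divides the `(N + 1)`-st power of the transform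
germ of `d` (it is `x · st ^ (N + 1)` where the latter is `(x · st) ^ (N + 1)`). -/
theorem isTransform_pow_dvd {Φ : Fin 2 → MvPowerSeries (Fin 2) k} (hΦ : HasSubst Φ)
    {d D E : MvPowerSeries (Fin 2) k} {N : ℕ} (hD : PlaneGerm.IsTransform Φ d D)
    (hE : PlaneGerm.IsTransform Φ (d ^ (N + 1)) E) : E ∣ D ^ (N + 1) := by
  obtain ⟨m, st, hm, hsub, rfl⟩ := hD
  obtain ⟨M, ST, hM, hSUB, rfl⟩ := hE
  have hMm : M = m * (N + 1) := by
    rw [order_pow_succ hm N] at hM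
    exact_mod_cast hM.symm
  subst hMm
  rw [subst_pow hΦ, hsub, mul_pow, ← pow_mul] at hSUB
  have hst : st ^ (N + 1) = ST :=
    mul_left_cancel₀ (pow_ne_zero _ (FormalCoordChange.X_ne_zero' (0 : Fin 2))) hSUB
  exact Dvd.intro (X 0 ^ N) (by rw [← hst]; ring)

/-- SUCCESSORS LIFT ALONG RADICAL DIVISIBILITY: in a chart whose components are divisible by `x`, if
`d ≠ 0`, `b ∣ d ^ (N + 1)` and `D` is the transform germ of `b`, then the transform germ `D'` of `d` exists
and `D ∣ D' ^ (N + 1)`. -/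
theorem exists_isTransform_of_dvd_pow {Φ : Fin 2 → MvPowerSeries (Fin 2) k} (hΦ : HasSubst Φ)
    (hX : ∀ i, (X 0 : MvPowerSeries (Fin 2) k) ∣ Φ i) {b d D : MvPowerSeries (Fin 2) k} {N : ℕ}
    (hd : d ≠ 0) (hbd : b ∣ d ^ (N + 1)) (hD : PlaneGerm.IsTransform Φ b D) :
    ∃ D', PlaneGerm.IsTransform Φ d D' ∧ D ∣ D' ^ (N + 1) := by
  obtain ⟨q, hq⟩ := hbd
  have hq0 : q ≠ 0 := right_ne_zero_of_mul (hq ▸ pow_ne_zero _ hd)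
  obtain ⟨E, hE⟩ := PlaneGerm.exists_isTransform hΦ hX hq0
  obtain ⟨D'', hD'', hDD''⟩ := PlaneGerm.exists_isTransform_mul hΦ hD hE
  rw [← hq] at hD''
  obtain ⟨D', hD'⟩ := PlaneGerm.exists_isTransform hΦ hX hd
  exact ⟨D', hD', hDD''.trans (isTransform_pow_dvd hΦ hD' hD'')⟩

/-! ### Bad chains lift along radical divisibility -/

/-- Bad chains lift along radical divisibility `b ∣ d ^ (N + 1)`, `d ≠ 0` (the radical analogue of
`NonNCCountAssembly.chain_of_dvd`: transforms lift chart by chart with the same `N`, successors are non-zero,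
and normal-crossing support descends to radical divisors). -/
theorem chain_of_dvd_pow (H : ℕ → MvPowerSeries (Fin 2) k → Prop) (hH0 : ∀ b, H 0 b)
    (hHs : ∀ n b, H (n + 1) b ↔ ∃ D, PlaneGerm.IsBadStep b D ∧ H n D) (N : ℕ) :
    ∀ (n : ℕ) (b d : MvPowerSeries (Fin 2) k), d ≠ 0 → b ∣ d ^ (N + 1) → H n b → H n d := by
  -- adapted from `NonNCCountAssembly.chain_of_dvd`
  have hNe : ∀ b D : MvPowerSeries (Fin 2) k, PlaneGerm.IsSuccessor b D → D ≠ 0 :=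
    (stub_blowupSuccessorToolkit k).2.2.1
  intro n
  induction n with
  | zero => exact fun _ d _ _ _ => hH0 d
  | succ n ih =>
    intro b d hd hbd hn
    obtain ⟨D, ⟨_, hnc, hsucc⟩, hnD⟩ := (hHs n b).1 hn
    have hncd : ¬ PlaneGerm.IsNC d := fun h => hnc (isNC_of_dvd_pow hbd h)
    rcases hsucc with ⟨t, ht⟩ | hv
    · obtain ⟨D', hD', hDD'⟩ := exists_isTransform_of_dvd_pow (PlaneGerm.hasSubst_dirChart t)
        (PlaneGerm.X_dvd_dirChart t) hd hbd ht
      exact (hHs n d).2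
        ⟨D', ⟨hd, hncd, Or.inl ⟨t, hD'⟩⟩, ih D D' (hNe d D' (Or.inl ⟨t, hD'⟩)) hDD' hnD⟩
    · obtain ⟨D', hD', hDD'⟩ := exists_isTransform_of_dvd_pow PlaneGerm.hasSubst_vertChart
        PlaneGerm.X_dvd_vertChart hd hbd hv
      exact (hHs n d).2 ⟨D', ⟨hd, hncd, Or.inr hD'⟩, ih D D' (hNe d D' (Or.inr hD')) hDD' hnD⟩

end PlaneCountRadical

/-- **Stub S3a of the line `hasse-ridge-face-selection` (v16).**  THE NON-NORMAL-CROSSING COUNT IN RADICAL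
FORM, over every field: the Literature named fact `PlaneGermNonNCCountRad k` (`PlaneGermNonNCCount` with (ii)
strengthened to `b ∣ d ^ (N + 1) → ν b ≤ ν d`), with `ν b :=` the length of the longest chain of bad steps from
`b` (the assembly of `stub_nonNCCountAssembly` fed with `stub_blowupSuccessorToolkit`, `stub_blowupScaling`,
`noInfiniteBadChain`, plus chain lifting along radical divisibility `PlaneCountRadical.chain_of_dvd_pow`). -/
theorem stub_planeCountRadical : ∀ (k : Type) [Field k], PlaneGermNonNCCountRad k := by
  -- adapted from `stub_nonNCCountAssembly`
  intro k _
  obtain ⟨hExist, hUniq, -, hFin, -, -⟩ := stub_blowupSuccessorToolkit k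
  obtain ⟨-, -, -, hEquiv, hInv, hLit⟩ := stub_blowupScaling k
  obtain ⟨H, hH0, hHs⟩ := NonNCCountAssembly.exists_chainPred (k := k)
  obtain ⟨ν, hle, hmem⟩ := NonNCCountAssembly.exists_count H hH0
    (NonNCCountAssembly.chain_bounded H hHs hExist hUniq hFin (noInfiniteBadChain k))
  refine ⟨ν, ?_, ?_, ?_⟩
  · -- (i): `ν b = 0` iff the support of `b` is a normal crossing
    intro b hb
    constructor
    · intro h0
      by_contra hnc
      obtain ⟨D, hD⟩ := (hExist b hb).1 0
      have h1b : H 1 b := (hHs 0 b).2 ⟨D, ⟨hb, hnc, Or.inl ⟨0, hD⟩⟩, hH0 D⟩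
      have h1le : 1 ≤ ν b := hle b 1 h1b
      omega
    · intro hnc
      exact NonNCCountAssembly.chain_eq_zero_of_not_bad H hHs (fun h => h.2 hnc) (hmem b)
  · -- (ii): monotone along radical divisibility
    intro b d hd N hbd
    exact hle d (ν b) (PlaneCountRadical.chain_of_dvd_pow H hH0 hHs N (ν b) b d hd hbd (hmem b))
  · -- (iii): strict drop at every exceptional point of the first blow-up
    intro b hb hnc c hc a G hfac hndvd
    obtain ⟨i, hci, D, μ, α, β, hμ, hα, hβ, hsucc, hEq⟩ := hLit b hb c hc a G hfac hndvd
    refine ⟨i, hci, ?_⟩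
    rw [hEq]
    have hD : H (ν (MvPowerSeries.C μ * MvPowerSeries.subst (PlaneGerm.diagScale α β) D)) D :=
      NonNCCountAssembly.chain_of_rescaled H hH0 hHs hExist hEquiv hInv _ μ α β D hμ hα hβ (hmem _)
    exact Nat.add_one_le_iff.mp (hle b _ ((hHs _ b).2 ⟨D, ⟨hb, hnc, hsucc⟩, hD⟩))

end Summit.ResolutionOfSingularities.ResolutionOfSingularities.Theorems
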